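import Summits.HodgeConjecture.HodgeConjecture.Theorems.Ring2WeilCoverageTypeNormSign
import HarnessLib

/-!
# Weil-type family coverage — THE NORM-SIGN LAW, principal reference: on `ℂ^Φ/D(𝔪)` the principal type `(ϖ₀)`
# occurs iff (an `ι`-compatible PRINCIPAL polarisation exists ⟺ `N_{K⁺/ℚ}(ϖ₀) > 0`); on the cyclotomic torus
# `ℂ^Φ/Φ(ℤ[ζₙ])` iff (`|S_Φ ∩ N_odd|` even ⟺ `N_{K⁺/ℚ}(ϖ₀) > 0`)

research route conditional on HC_CM; not a corollary; Q11.4-sentence-2 already refuted in dim ≥ 3.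

Ring 2, WEIL-TYPE FAMILY-COVERAGE CENSUS (`HOME/WEIL-FAMILY-COVERAGE.md` `## b01`, blocks b01.34–b01.41; owner ring2-b01),
part 55b of the `Ring2WeilCoverage*` series — the sequel of part 55 (`…TypeNormSign`: for any CM field `K`, CM type `Φ`,
lattice `𝔪`, type `𝔣₀` and real `ϖ₀ ∈ 𝓞 K⁺ ∖ 0`, under THEOREM L (i)/(ii) «type `(ϖ₀)𝔣₀` occurs» ⟺ («type `𝔣₀` occurs»
⟺ `N_{K⁺/ℚ}(ϖ₀) > 0`)).  Here the reference type is the principal one, `𝔣₀ = 𝔬₀` (`IsOfType 𝔪 ζ₀ ⊤`):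

* §6 **`exists_pos_isOfType_span_iff`**: «`ℂ^Φ/D(𝔪)` carries a `Φ`-positive divisor of type `(ϖ₀)`» ⟺ («it carries an
  `ι`-compatible PRINCIPAL polarisation» ⟺ `N_{K⁺/ℚ}(ϖ₀) > 0`); hence on a torus WITHOUT principal polarisation the
  principal types that occur are exactly the `(ϖ₀)` with `N_{K⁺/ℚ}(ϖ₀) < 0` (`…_iff_norm_neg`), and on a torus WITH one
  exactly those with `N_{K⁺/ℚ}(ϖ₀) > 0` (`…_iff_norm_pos`); for ANY `Φ`: `N(ϖ₀) < 0` ⇒ EXACTLY ONE of «principal»,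
  «type `(ϖ₀)`» (`xor_principal_span_of_norm_neg`), `N(ϖ₀) > 0` ⇒ both or neither
  (`exists_pos_isOfType_span_iff_principal_of_norm_pos`).
* `exists_pos_isOfType_realMul_of_even_iff` (§6) / `exists_type_span_of_even_iff` (§7): THEOREM L (ii) ALONE ⇒ type
  `(ϖ₀)𝔣₀` resp. `(ϖ₀)` OCCURS whenever the parities match (`#{Im ζ₀^φ < 0}` even ⟺ `N(ϖ₀) > 0`) — the existence half,
  for the levels where THEOREM L (i) is not a tree theorem.
* §7 the cyclotomic principal torus `ℂ^Φ/Φ(ℤ[ζₙ])` (`𝔪 = 1`, reference `ξ_k = ζ^k/Φₙ′(ζ)` of part 6′, `IsOfType 1 ξ_k ⊤`):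
  **`exists_type_span_iff_even_iff`**: «type `(ϖ₀)` occurs» ⟺ (`|S_Φ ∩ N_odd|` even ⟺ `N(ϖ₀) > 0`) (part 48's
  `exists_principal_iff_even`), with the two readings `exists_type_span_iff_norm_neg_of_odd` /
  `exists_type_span_iff_norm_pos_of_even` used by the level files (parts 56–): «⟺ `N(ϖ₀) < 0`» on every NO row, «⟺
  `N(ϖ₀) > 0`» on every YES row — for ALL real generators `ϖ₀` at once, no residue dictionary.

At the census's `h = 1` levels `M ∈ {21, 28, 33, 36, 44, 35, 45}` the class number of `ℚ(ζ_M)` is `1` [Was97 Thm. 11.1],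
so `h(ℚ(ζ_M)⁺) = 1` and EVERY type `𝔣₀ ⊆ 𝓞 K⁺` is principal: the law then describes ALL `ι`-compatible polarisation types
of the `K`-balanced points `ℂ^Φ/Φ(ℤ[ζ_M])` (S-pencil remark; the kernel statements quantify over principal `𝔣₀ = (ϖ₀)`).

HONEST FRAMING: torus-level statements about Shimura's divisors `X_ζ` of type `(K; Φ; 𝔣₀)` [Sh98 §14.3 Prop. 4–5] and
the norm of an element of `K⁺`; nothing here is a statement about Hodge classes, `W_K`, general members or HC; `HC_CM`
is used nowhere.  No `def`, no named fact, no `sorry`.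

References: [cite: Shimura1998, §14.3 Prop. 4–5, pp. 103–104]; [cite: Washington1997, Thm. 11.1]; census b01.41
(seat-derived).
-/

noncomputable section

open scoped Classical nonZeroDivisors NumberField ComplexConjugate
open NumberField NumberField.ComplexEmbedding Module FractionalIdeal Complex Polynomial

namespace Summit.HodgeConjecture.Ring2WeilCoverage.TypeNormSign

open Literature.AlgebraicGeometry.Motives (CMType)
open Literature.NumberTheory.ComplexMultiplication
open Literature.NumberTheory.ComplexMultiplication.CMTypeLattice
open Summit.HodgeConjecture.Ring2WeilCoverage.CMTypeSignParity
open Summit.HodgeConjecture.Ring2WeilCoverage.CMUnitSignature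

section General

variable {K : Type} [Field K] [NumberField K] [IsCMField K] (Φ : CMType K)
  (𝔪 : (FractionalIdeal (𝓞 K)⁰ K)ˣ) {ζ₀ : K}

/-! ### §6 The principal reference `𝔣₀ = 𝔬₀` -/

/-- **THEOREM L (ii) alone ⇒ EXISTENCE of type `(ϖ₀)𝔣₀`** when the negative count of `ζ₀` and the sign of `N(ϖ₀)`
have matching parities (`#{Im ζ₀^φ < 0}` even ⟺ `N_{K⁺/ℚ}(ϖ₀) > 0`): the twisted count is then even (part 55 §4) — the
half of the law that needs no hypothesis on the norms of units (used at the levels where THEOREM L (i) is not in the tree).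
research route conditional on HC_CM; not a corollary; Q11.4-sentence-2 already refuted in dim ≥ 3. [cite: Shimura1998, §14.3 Prop. 4–5, pp. 103–104] -/
theorem exists_pos_isOfType_realMul_of_even_iff {𝔣₀ : Ideal (𝓞 (maximalRealSubfield K))}
    (hζ₀ : IsCMField.complexConj K ζ₀ = -ζ₀) (h0 : ζ₀ ≠ 0) (hT : IsOfType 𝔪 ζ₀ 𝔣₀)
    {ϖ₀ : 𝓞 (maximalRealSubfield K)} (hϖ0 : ϖ₀ ≠ 0)
    (hU' : ∀ S : Set (K →+* ℂ), S ⊆ Φ.1 → Even S.ncard →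
      ∃ u : (𝓞 K)ˣ, IsCMField.complexConj K ((u : 𝓞 K) : K) = ((u : 𝓞 K) : K) ∧
        ∀ φ ∈ Φ.1, ((φ ((u : 𝓞 K) : K)).re < 0 ↔ φ ∈ S))
    (hiff : Even ((Φ.1 ∩ {ψ : K →+* ℂ | (ψ ζ₀).im < 0}).ncard) ↔
      0 < Algebra.norm ℚ ((ϖ₀ : maximalRealSubfield K))) :
    ∃ ζ : K, IsCMField.complexConj K ζ = -ζ ∧ (∀ φ : Φ.1, 0 < (φ.1 ζ).im) ∧
        IsOfType 𝔪 ζ (Ideal.span {ϖ₀} * 𝔣₀) :=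
  exists_pos_isOfType_of_even Φ 𝔪 (complexConj_realMul ϖ₀ hζ₀)
    (mul_ne_zero (algebraMap_ringOfIntegers_ne_zero hϖ0) h0) (isOfType_realMul 𝔪 ϖ₀ hT) hU'
    ((even_ncard_negSet_realMul_iff Φ hϖ0 hζ₀ h0).mpr hiff)

/-- **Type `(ϖ₀)` versus PRINCIPAL.**  Under THEOREM L (i)/(ii), with `ζ₀ ≠ 0` any skew element with
`IsOfType 𝔪 ζ₀ ⊤` (`ζ₀𝔡𝔪𝔪^ρ = 𝔬`; e.g. a skew generator of `(𝔡𝔪𝔪^ρ)⁻¹`): **`ℂ^Φ/D(𝔪)` carries a `Φ`-positive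
divisor of the principal type `(ϖ₀)` iff (it carries an `ι`-compatible PRINCIPAL polarisation ⟺ `N_{K⁺/ℚ}(ϖ₀) > 0`)**.
research route conditional on HC_CM; not a corollary; Q11.4-sentence-2 already refuted in dim ≥ 3. [cite: Shimura1998, §14.3 Prop. 4–5, pp. 103–104] -/
theorem exists_pos_isOfType_span_iff (hζ₀ : IsCMField.complexConj K ζ₀ = -ζ₀) (h0 : ζ₀ ≠ 0)
    (hT : IsOfType 𝔪 ζ₀ ⊤) {ϖ₀ : 𝓞 (maximalRealSubfield K)} (hϖ0 : ϖ₀ ≠ 0)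
    (hN : ∀ v : (𝓞 (maximalRealSubfield K))ˣ,
      0 < Algebra.norm ℚ (((v : 𝓞 (maximalRealSubfield K)) : maximalRealSubfield K)))
    (hU' : ∀ S : Set (K →+* ℂ), S ⊆ Φ.1 → Even S.ncard →
      ∃ u : (𝓞 K)ˣ, IsCMField.complexConj K ((u : 𝓞 K) : K) = ((u : 𝓞 K) : K) ∧
        ∀ φ ∈ Φ.1, ((φ ((u : 𝓞 K) : K)).re < 0 ↔ φ ∈ S)) :
    (∃ ζ : K, IsCMField.complexConj K ζ = -ζ ∧ (∀ φ : Φ.1, 0 < (φ.1 ζ).im) ∧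
        IsOfType 𝔪 ζ (Ideal.span {ϖ₀})) ↔
      ((∃ ζ : K, IsCMField.complexConj K ζ = -ζ ∧ (∀ φ : Φ.1, 0 < (φ.1 ζ).im) ∧ IsOfType 𝔪 ζ ⊤) ↔
        0 < Algebra.norm ℚ ((ϖ₀ : maximalRealSubfield K))) := by
  have h := exists_pos_isOfType_realMul_iff Φ 𝔪 hζ₀ h0 hT hϖ0 hN hU'
  rwa [Ideal.mul_top] at h

/-- **On a torus WITHOUT principal polarisation, type `(ϖ₀)` occurs iff `N_{K⁺/ℚ}(ϖ₀) < 0`** (THEOREM L (i)/(ii)).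
research route conditional on HC_CM; not a corollary; Q11.4-sentence-2 already refuted in dim ≥ 3. [cite: Shimura1998, §14.3 Prop. 4–5, pp. 103–104] -/
theorem exists_pos_isOfType_span_iff_norm_neg (hζ₀ : IsCMField.complexConj K ζ₀ = -ζ₀) (h0 : ζ₀ ≠ 0)
    (hT : IsOfType 𝔪 ζ₀ ⊤) {ϖ₀ : 𝓞 (maximalRealSubfield K)} (hϖ0 : ϖ₀ ≠ 0)
    (hN : ∀ v : (𝓞 (maximalRealSubfield K))ˣ,
      0 < Algebra.norm ℚ (((v : 𝓞 (maximalRealSubfield K)) : maximalRealSubfield K)))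
    (hU' : ∀ S : Set (K →+* ℂ), S ⊆ Φ.1 → Even S.ncard →
      ∃ u : (𝓞 K)ˣ, IsCMField.complexConj K ((u : 𝓞 K) : K) = ((u : 𝓞 K) : K) ∧
        ∀ φ ∈ Φ.1, ((φ ((u : 𝓞 K) : K)).re < 0 ↔ φ ∈ S))
    (hno : ¬ ∃ ζ : K, IsCMField.complexConj K ζ = -ζ ∧ (∀ φ : Φ.1, 0 < (φ.1 ζ).im) ∧ IsOfType 𝔪 ζ ⊤) :
    (∃ ζ : K, IsCMField.complexConj K ζ = -ζ ∧ (∀ φ : Φ.1, 0 < (φ.1 ζ).im) ∧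
        IsOfType 𝔪 ζ (Ideal.span {ϖ₀})) ↔
      Algebra.norm ℚ ((ϖ₀ : maximalRealSubfield K)) < 0 := by
  have hne : Algebra.norm ℚ ((ϖ₀ : maximalRealSubfield K)) ≠ 0 := by
    rw [Algebra.norm_ne_zero_iff]
    intro h
    apply hϖ0
    exact_mod_cast h
  rw [exists_pos_isOfType_span_iff Φ 𝔪 hζ₀ h0 hT hϖ0 hN hU']
  constructor
  · intro h
    rcases lt_trichotomy (Algebra.norm ℚ ((ϖ₀ : maximalRealSubfield K))) 0 with hlt | heq | hgt
    · exact hlt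
    · exact absurd heq hne
    · exact absurd (h.mpr hgt) hno
  · intro hlt
    exact ⟨fun h => absurd h hno, fun h => absurd hlt (lt_asymm h)⟩

/-- **On a torus WITH a principal polarisation, type `(ϖ₀)` occurs iff `N_{K⁺/ℚ}(ϖ₀) > 0`** (THEOREM L (i)/(ii)).
research route conditional on HC_CM; not a corollary; Q11.4-sentence-2 already refuted in dim ≥ 3. [cite: Shimura1998, §14.3 Prop. 4–5, pp. 103–104] -/
theorem exists_pos_isOfType_span_iff_norm_pos (hζ₀ : IsCMField.complexConj K ζ₀ = -ζ₀) (h0 : ζ₀ ≠ 0)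
    (hT : IsOfType 𝔪 ζ₀ ⊤) {ϖ₀ : 𝓞 (maximalRealSubfield K)} (hϖ0 : ϖ₀ ≠ 0)
    (hN : ∀ v : (𝓞 (maximalRealSubfield K))ˣ,
      0 < Algebra.norm ℚ (((v : 𝓞 (maximalRealSubfield K)) : maximalRealSubfield K)))
    (hU' : ∀ S : Set (K →+* ℂ), S ⊆ Φ.1 → Even S.ncard →
      ∃ u : (𝓞 K)ˣ, IsCMField.complexConj K ((u : 𝓞 K) : K) = ((u : 𝓞 K) : K) ∧
        ∀ φ ∈ Φ.1, ((φ ((u : 𝓞 K) : K)).re < 0 ↔ φ ∈ S))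
    (hyes : ∃ ζ : K, IsCMField.complexConj K ζ = -ζ ∧ (∀ φ : Φ.1, 0 < (φ.1 ζ).im) ∧ IsOfType 𝔪 ζ ⊤) :
    (∃ ζ : K, IsCMField.complexConj K ζ = -ζ ∧ (∀ φ : Φ.1, 0 < (φ.1 ζ).im) ∧
        IsOfType 𝔪 ζ (Ideal.span {ϖ₀})) ↔
      0 < Algebra.norm ℚ ((ϖ₀ : maximalRealSubfield K)) := by
  rw [exists_pos_isOfType_span_iff Φ 𝔪 hζ₀ h0 hT hϖ0 hN hU']
  exact ⟨fun h => h.mp hyes, fun h => ⟨fun _ => h, fun _ => hyes⟩⟩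

/-- **Negative norm ⇒ EXACTLY ONE of «principal», «type `(ϖ₀)`»** on `ℂ^Φ/D(𝔪)` (THEOREM L (i)/(ii); any CM type `Φ`,
balanced or not): the dichotomy of parts 48–54 for every real generator of negative norm at once.
research route conditional on HC_CM; not a corollary; Q11.4-sentence-2 already refuted in dim ≥ 3. [cite: Shimura1998, §14.3 Prop. 4–5, pp. 103–104] -/
theorem xor_principal_span_of_norm_neg (hζ₀ : IsCMField.complexConj K ζ₀ = -ζ₀) (h0 : ζ₀ ≠ 0)
    (hT : IsOfType 𝔪 ζ₀ ⊤) {ϖ₀ : 𝓞 (maximalRealSubfield K)}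
    (hneg : Algebra.norm ℚ ((ϖ₀ : maximalRealSubfield K)) < 0)
    (hN : ∀ v : (𝓞 (maximalRealSubfield K))ˣ,
      0 < Algebra.norm ℚ (((v : 𝓞 (maximalRealSubfield K)) : maximalRealSubfield K)))
    (hU' : ∀ S : Set (K →+* ℂ), S ⊆ Φ.1 → Even S.ncard →
      ∃ u : (𝓞 K)ˣ, IsCMField.complexConj K ((u : 𝓞 K) : K) = ((u : 𝓞 K) : K) ∧
        ∀ φ ∈ Φ.1, ((φ ((u : 𝓞 K) : K)).re < 0 ↔ φ ∈ S)) :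
    Xor (∃ ζ : K, IsCMField.complexConj K ζ = -ζ ∧ (∀ φ : Φ.1, 0 < (φ.1 ζ).im) ∧ IsOfType 𝔪 ζ ⊤)
      (∃ ζ : K, IsCMField.complexConj K ζ = -ζ ∧ (∀ φ : Φ.1, 0 < (φ.1 ζ).im) ∧
        IsOfType 𝔪 ζ (Ideal.span {ϖ₀})) := by
  have h := exists_pos_isOfType_realMul_iff_not_of_norm_neg Φ 𝔪 hζ₀ h0 hT hneg hN hU'
  rw [Ideal.mul_top] at h
  by_cases hp : ∃ ζ : K, IsCMField.complexConj K ζ = -ζ ∧ (∀ φ : Φ.1, 0 < (φ.1 ζ).im) ∧ IsOfType 𝔪 ζ ⊤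
  · exact Or.inl ⟨hp, fun h' => (h.mp h') hp⟩
  · exact Or.inr ⟨h.mpr hp, hp⟩

/-- **Positive norm ⇒ type `(ϖ₀)` occurs iff a principal polarisation does** (THEOREM L (i)/(ii); any `Φ`).
research route conditional on HC_CM; not a corollary; Q11.4-sentence-2 already refuted in dim ≥ 3. [cite: Shimura1998, §14.3 Prop. 4–5, pp. 103–104] -/
theorem exists_pos_isOfType_span_iff_principal_of_norm_pos (hζ₀ : IsCMField.complexConj K ζ₀ = -ζ₀) (h0 : ζ₀ ≠ 0)
    (hT : IsOfType 𝔪 ζ₀ ⊤) {ϖ₀ : 𝓞 (maximalRealSubfield K)}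
    (hpos : 0 < Algebra.norm ℚ ((ϖ₀ : maximalRealSubfield K)))
    (hN : ∀ v : (𝓞 (maximalRealSubfield K))ˣ,
      0 < Algebra.norm ℚ (((v : 𝓞 (maximalRealSubfield K)) : maximalRealSubfield K)))
    (hU' : ∀ S : Set (K →+* ℂ), S ⊆ Φ.1 → Even S.ncard →
      ∃ u : (𝓞 K)ˣ, IsCMField.complexConj K ((u : 𝓞 K) : K) = ((u : 𝓞 K) : K) ∧
        ∀ φ ∈ Φ.1, ((φ ((u : 𝓞 K) : K)).re < 0 ↔ φ ∈ S)) :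
    (∃ ζ : K, IsCMField.complexConj K ζ = -ζ ∧ (∀ φ : Φ.1, 0 < (φ.1 ζ).im) ∧
        IsOfType 𝔪 ζ (Ideal.span {ϖ₀})) ↔
      (∃ ζ : K, IsCMField.complexConj K ζ = -ζ ∧ (∀ φ : Φ.1, 0 < (φ.1 ζ).im) ∧ IsOfType 𝔪 ζ ⊤) := by
  have h := exists_pos_isOfType_realMul_iff_of_norm_pos Φ 𝔪 hζ₀ h0 hT hpos hN hU'
  rwa [Ideal.mul_top] at h

end General

/-! ### §7 The cyclotomic principal torus `ℂ^Φ/Φ(ℤ[ζₙ])` (`𝔪 = 1`, reference `ξ_k = ζ^k/Φₙ′(ζ)`) -/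

section Cyclotomic

open Summit.HodgeConjecture.Ring2WeilCoverage.CyclotomicDifferent
open Summit.HodgeConjecture.Ring2WeilCoverage.CyclotomicPrincipalObstruction
open Summit.HodgeConjecture.Ring2WeilCoverage.RamifiedTypes (exists_principal_iff_even)

variable {K : Type} [Field K] [NumberField K] {n : ℕ} [NeZero n] {ζ : K}

/-- `𝐞(t) = exp(2πi t/n) ∈ ℂ` (`ZMod.toCircle`). -/
local notation3 (prettyPrint := false) "𝐞 " t:max => ((ZMod.toCircle t : Circle) : ℂ)

/-- The census's set `N_odd` = the unit residues at odd positions (`below` even), part 5. -/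
local notation3 (prettyPrint := false) "Nodd" =>
  (Finset.univ.filter fun t : ZMod n => t.val.Coprime n ∧
    Even (Finset.card (Finset.filter (fun s : ZMod n => s.val.Coprime n ∧ s.val < t.val) Finset.univ)))

open scoped Classical in
/-- **Type `(ϖ₀)` on `ℂ^Φ/Φ(ℤ[ζₙ])` ⟺ (`|S_Φ ∩ N_odd|` even ⟺ `N_{K⁺/ℚ}(ϖ₀) > 0`)**, under THEOREM L (i) (`hN`) and THEOREM
L (ii) on `Φ` (`hU'`): §6 with the reference `ξ_k = ζ^k/Φₙ′(ζ)` (`IsOfType 1 ξ_k ⊤`, part 6′) and part 48's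
`exists_principal_iff_even` (principal ⟺ `|S_Φ ∩ N_odd|` even).  For EVERY real generator `ϖ₀ ∈ 𝓞 K⁺ ∖ 0` at once — no
residue dictionary for `ϖ₀` is needed.
research route conditional on HC_CM; not a corollary; Q11.4-sentence-2 already refuted in dim ≥ 3. [cite: Shimura1998, §14.3 Prop. 4–5, pp. 103–104] -/
theorem exists_type_span_iff_even_iff [IsCyclotomicExtension {n} ℚ K] [IsCMField K] (hζ : IsPrimitiveRoot ζ n)
    {k : ℕ} (hg : Nat.totient n = 2 * (k + 1)) (Φ : CMType K) {ϖ₀ : 𝓞 (maximalRealSubfield K)} (hϖ0 : ϖ₀ ≠ 0)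
    (hN : ∀ v : (𝓞 (maximalRealSubfield K))ˣ,
      0 < Algebra.norm ℚ (((v : 𝓞 (maximalRealSubfield K)) : maximalRealSubfield K)))
    (hU' : ∀ S : Set (K →+* ℂ), S ⊆ Φ.1 → Even S.ncard →
      ∃ u : (𝓞 K)ˣ, IsCMField.complexConj K ((u : 𝓞 K) : K) = ((u : 𝓞 K) : K) ∧
        ∀ φ ∈ Φ.1, ((φ ((u : 𝓞 K) : K)).re < 0 ↔ φ ∈ S)) :
    (∃ ζ' : K, IsCMField.complexConj K ζ' = -ζ' ∧ (∀ φ : Φ.1, 0 < (φ.1 ζ').im) ∧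
        IsOfType (1 : (FractionalIdeal (𝓞 K)⁰ K)ˣ) ζ' (Ideal.span {ϖ₀})) ↔
      (Even ((Finset.univ.filter fun t : ZMod n => ∃ σ ∈ Φ.1, σ ζ = 𝐞 t) ∩ Nodd).card ↔
        0 < Algebra.norm ℚ ((ϖ₀ : maximalRealSubfield K))) := by
  rw [exists_pos_isOfType_span_iff Φ 1 (complexConj_xi hζ hg) (xi_ne_zero hζ k) (isOfType_one_xi_top hζ k)
      hϖ0 hN hU', exists_principal_iff_even hζ hg Φ hN hU']

open scoped Classical in
/-- **ODD `|S_Φ ∩ N_odd|` (no principal polarisation) ⇒ type `(ϖ₀)` occurs on `ℂ^Φ/Φ(ℤ[ζₙ])` iff `N_{K⁺/ℚ}(ϖ₀) < 0`.**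
research route conditional on HC_CM; not a corollary; Q11.4-sentence-2 already refuted in dim ≥ 3. [cite: Shimura1998, §14.3 Prop. 4–5, pp. 103–104] -/
theorem exists_type_span_iff_norm_neg_of_odd [IsCyclotomicExtension {n} ℚ K] [IsCMField K]
    (hζ : IsPrimitiveRoot ζ n) {k : ℕ} (hg : Nat.totient n = 2 * (k + 1)) (Φ : CMType K)
    {ϖ₀ : 𝓞 (maximalRealSubfield K)} (hϖ0 : ϖ₀ ≠ 0)
    (hN : ∀ v : (𝓞 (maximalRealSubfield K))ˣ,
      0 < Algebra.norm ℚ (((v : 𝓞 (maximalRealSubfield K)) : maximalRealSubfield K)))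
    (hU' : ∀ S : Set (K →+* ℂ), S ⊆ Φ.1 → Even S.ncard →
      ∃ u : (𝓞 K)ˣ, IsCMField.complexConj K ((u : 𝓞 K) : K) = ((u : 𝓞 K) : K) ∧
        ∀ φ ∈ Φ.1, ((φ ((u : 𝓞 K) : K)).re < 0 ↔ φ ∈ S))
    (hodd : Odd ((Finset.univ.filter fun t : ZMod n => ∃ σ ∈ Φ.1, σ ζ = 𝐞 t) ∩ Nodd).card) :
    (∃ ζ' : K, IsCMField.complexConj K ζ' = -ζ' ∧ (∀ φ : Φ.1, 0 < (φ.1 ζ').im) ∧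
        IsOfType (1 : (FractionalIdeal (𝓞 K)⁰ K)ˣ) ζ' (Ideal.span {ϖ₀})) ↔
      Algebra.norm ℚ ((ϖ₀ : maximalRealSubfield K)) < 0 := by
  have hne : Algebra.norm ℚ ((ϖ₀ : maximalRealSubfield K)) ≠ 0 := by
    rw [Algebra.norm_ne_zero_iff]
    intro h
    apply hϖ0
    exact_mod_cast h
  rw [exists_type_span_iff_even_iff hζ hg Φ hϖ0 hN hU']
  have hno := Nat.not_even_iff_odd.mpr hodd
  constructor
  · intro h
    rcases lt_trichotomy (Algebra.norm ℚ ((ϖ₀ : maximalRealSubfield K))) 0 with hlt | heq | hgt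
    · exact hlt
    · exact absurd heq hne
    · exact absurd (h.mpr hgt) hno
  · intro hlt
    exact ⟨fun h => absurd h hno, fun h => absurd hlt (lt_asymm h)⟩

open scoped Classical in
/-- **EVEN `|S_Φ ∩ N_odd|` (a principal polarisation exists) ⇒ type `(ϖ₀)` occurs on `ℂ^Φ/Φ(ℤ[ζₙ])` iff
`N_{K⁺/ℚ}(ϖ₀) > 0`.**
research route conditional on HC_CM; not a corollary; Q11.4-sentence-2 already refuted in dim ≥ 3. [cite: Shimura1998, §14.3 Prop. 4–5, pp. 103–104] -/
theorem exists_type_span_iff_norm_pos_of_even [IsCyclotomicExtension {n} ℚ K] [IsCMField K]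
    (hζ : IsPrimitiveRoot ζ n) {k : ℕ} (hg : Nat.totient n = 2 * (k + 1)) (Φ : CMType K)
    {ϖ₀ : 𝓞 (maximalRealSubfield K)} (hϖ0 : ϖ₀ ≠ 0)
    (hN : ∀ v : (𝓞 (maximalRealSubfield K))ˣ,
      0 < Algebra.norm ℚ (((v : 𝓞 (maximalRealSubfield K)) : maximalRealSubfield K)))
    (hU' : ∀ S : Set (K →+* ℂ), S ⊆ Φ.1 → Even S.ncard →
      ∃ u : (𝓞 K)ˣ, IsCMField.complexConj K ((u : 𝓞 K) : K) = ((u : 𝓞 K) : K) ∧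
        ∀ φ ∈ Φ.1, ((φ ((u : 𝓞 K) : K)).re < 0 ↔ φ ∈ S))
    (heven : Even ((Finset.univ.filter fun t : ZMod n => ∃ σ ∈ Φ.1, σ ζ = 𝐞 t) ∩ Nodd).card) :
    (∃ ζ' : K, IsCMField.complexConj K ζ' = -ζ' ∧ (∀ φ : Φ.1, 0 < (φ.1 ζ').im) ∧
        IsOfType (1 : (FractionalIdeal (𝓞 K)⁰ K)ˣ) ζ' (Ideal.span {ϖ₀})) ↔
      0 < Algebra.norm ℚ ((ϖ₀ : maximalRealSubfield K)) := by
  rw [exists_type_span_iff_even_iff hζ hg Φ hϖ0 hN hU']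
  exact ⟨fun h => h.mp heven, fun h => ⟨fun _ => h, fun _ => heven⟩⟩

open scoped Classical in
/-- **THEOREM L (ii) alone ⇒ type `(ϖ₀)` OCCURS on `ℂ^Φ/Φ(ℤ[ζₙ])`** whenever (`|S_Φ ∩ N_odd|` even ⟺ `N_{K⁺/ℚ}(ϖ₀) > 0`) — e.g.
`|S_Φ ∩ N_odd|` even and `N(ϖ₀) > 0`, or both odd/negative; no hypothesis on the norms of units (for the census levels where
only THEOREM L (ii) is a tree theorem).  `#{φ ∈ Φ : Im ξ^φ < 0} = |S_Φ ∩ N_odd|` is part 6/7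
(`ncard_inter_negSet_eq_card_inter_nodd`).
research route conditional on HC_CM; not a corollary; Q11.4-sentence-2 already refuted in dim ≥ 3. [cite: Shimura1998, §14.3 Prop. 4–5, pp. 103–104] -/
theorem exists_type_span_of_even_iff [IsCyclotomicExtension {n} ℚ K] [IsCMField K] (hζ : IsPrimitiveRoot ζ n)
    {k : ℕ} (hg : Nat.totient n = 2 * (k + 1)) (Φ : CMType K) {ϖ₀ : 𝓞 (maximalRealSubfield K)} (hϖ0 : ϖ₀ ≠ 0)
    (hU' : ∀ S : Set (K →+* ℂ), S ⊆ Φ.1 → Even S.ncard →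
      ∃ u : (𝓞 K)ˣ, IsCMField.complexConj K ((u : 𝓞 K) : K) = ((u : 𝓞 K) : K) ∧
        ∀ φ ∈ Φ.1, ((φ ((u : 𝓞 K) : K)).re < 0 ↔ φ ∈ S))
    (hiff : Even ((Finset.univ.filter fun t : ZMod n => ∃ σ ∈ Φ.1, σ ζ = 𝐞 t) ∩ Nodd).card ↔
      0 < Algebra.norm ℚ ((ϖ₀ : maximalRealSubfield K))) :
    ∃ ζ' : K, IsCMField.complexConj K ζ' = -ζ' ∧ (∀ φ : Φ.1, 0 < (φ.1 ζ').im) ∧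
        IsOfType (1 : (FractionalIdeal (𝓞 K)⁰ K)ˣ) ζ' (Ideal.span {ϖ₀}) := by
  have h := exists_pos_isOfType_realMul_of_even_iff Φ 1 (complexConj_xi hζ hg) (xi_ne_zero hζ k)
    (isOfType_one_xi_top hζ k) hϖ0 hU' (by rw [ncard_inter_negSet_eq_card_inter_nodd hζ hg Φ]; exact hiff)
  rwa [Ideal.mul_top] at h

end Cyclotomic

end Summit.HodgeConjecture.Ring2WeilCoverage.TypeNormSign

end
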